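import Literature.AlgebraicGeometry.HodgeTheory.FermatSectionChartIdeal
import Literature.AlgebraicGeometry.HodgeTheory.FermatHypersurfaceReduction
import Literature.AlgebraicGeometry.HodgeTheory.FermatAffineChart
import Literature.AlgebraicGeometry.Motives.HypersurfaceChartEquation
import Literature.AlgebraicGeometry.Motives.GeneratingSectionsRatFn
import HarnessLib

/-!
# Shioda–Katsura's rational map `ψ : Xʳ⁺¹ₘ × X¹ₘ ⇢ Xʳ⁺²ₘ`: its homogeneous coordinates in `K(M)`

Topic `Literature/AlgebraicGeometry/HodgeTheory`; theorem-only. On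
`M = Xʳ⁺¹ₘ × (X¹ₘ × W)` (coordinates `x₀, …, x_{r+2}` on the first factor, `y₀, y₁, y₂` on the
curve) Shioda–Katsura's rational map (Tôhoku Math. J. 31 (1979), (1.8)) is
`ψ(x, y) = (y₂ x₀ : ⋯ : y₂ x_{r+1} : ε x_{r+2} y₀ : ε x_{r+2} y₁)`, `εᵐ = -1`. Dividing by
`x₀ y₀` gives its vector of homogeneous coordinates in the function field `K(M)`:
`ζ = (β₂ α₀, …, β₂ α_{r+1}, ε α_{r+2} β₀, ε α_{r+2} β₁)` with `α_j = [x_j/x₀]`, `β_l = [y_l/y₀]`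
(the generating sections `GeneratingSections.ofHom (pr ≫ ι)` read in `K(M)`). This file proves:

* `sum_zeta_pow_eq_zero` — `Σ_c ζ_cᵐ = 0` (from the Fermat equations `Σ α_jᵐ = 0 = Σ β_lᵐ`,
  `Motives/HypersurfaceChartEquation`), i.e. `ψ` lands in `Xʳ⁺²ₘ`;
* `zeta_eq_mul_ofSection` — on the chart `{x_i ≠ 0, y_l ≠ 0}` of `M`, `ζ_c = (α_i β_l) · [w_c]` for
  the explicit regular sections `w = (v a_j ; ε u b_{l'})`, `a_j = x_j/x_i`, `u = x_{r+2}/x_i`,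
  `b_{l'} = y_{l'}/y_l`, `v = y₂/y_l`, with `α_i β_l ≠ 0`.

## References

* T. Shioda, T. Katsura, On Fermat varieties, Tôhoku Math. J. 31 (1979) 97–115, §1 (1.8),
  Thm. 1.7 (i). [ShiodaKatsura1979]
-/

noncomputable section

open CategoryTheory CategoryTheory.Limits AlgebraicGeometry MonoidalCategory TopologicalSpace
  Opposite

namespace Literature.AlgebraicGeometry.HodgeTheory

open Literature.AlgebraicGeometry.Motives Literature.AlgebraicGeometry.Resolution

/-- A `ℂ`-scheme with a point maps onto `Spec ℂ`. [folklore] -/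
theorem surjective_hom_of_nonempty (X : SchemeOver ℂ) [Nonempty X.left] : Surjective X.hom :=
  ⟨fun p ↦ ⟨Nonempty.some ‹_›, Subsingleton.elim (α := PrimeSpectrum ℂ) _ _⟩⟩

variable {m : ℕ} (hm : 1 ≤ m) (r : ℕ) (W : SchemeOver ℂ)

set_option quotPrecheck false in
/-- Local notation: the first factor `X = Xʳ⁺¹ₘ`. -/
local notation "XX" => fermatHypersurface (r + 1) m

set_option quotPrecheck false in
/-- Local notation: the Fermat curve `C = X¹ₘ`. -/
local notation "CC" => fermatHypersurface 1 m

set_option quotPrecheck false in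
/-- Local notation: `M = X × (C × W)` as a scheme. -/
local notation "MM" => pullback (Over.hom XX) (Over.hom (CC ⊗ W))

set_option quotPrecheck false in
/-- Local notation: the projection `M → X`. -/
local notation "pX" => pullback.fst (Over.hom XX) (Over.hom (CC ⊗ W))

set_option quotPrecheck false in
/-- Local notation: the projection `M → C`. -/
local notation "pC" => (pullback.snd (Over.hom XX) (Over.hom (CC ⊗ W)) ≫ pullback.fst (Over.hom CC) W.hom)

set_option quotPrecheck false in
/-- Local notation: `ι : X ↪ ℙʳ⁺²`. -/
local notation "ιX" => Over.Hom.left (SmoothHypersurface.hypersurfaceι (fermatPolynomial ℂ (r + 1) m))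

set_option quotPrecheck false in
/-- Local notation: `ι : C ↪ ℙ²`. -/
local notation "ιC" => Over.Hom.left (SmoothHypersurface.hypersurfaceι (fermatPolynomial ℂ 1 m))

set_option quotPrecheck false in
/-- Local notation: the charts `{x_i ≠ 0}` of `M` (`GeneratingSections.preU`). -/
local notation "UX" => GeneratingSections.preU (pX ≫ ιX)

set_option quotPrecheck false in
/-- Local notation: the charts `{y_l ≠ 0}` of `M`. -/
local notation "UC" => GeneratingSections.preU (pC ≫ ιC)

set_option quotPrecheck false in
/-- Local notation: the ratios `x_j/x_i` on `M` (`GeneratingSections.homRatio`). -/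
local notation "ρX" => GeneratingSections.homRatio (pX ≫ ιX)

set_option quotPrecheck false in
/-- Local notation: the ratios `y_{l'}/y_l` on `M`. -/
local notation "ρC" => GeneratingSections.homRatio (pC ≫ ιC)

attribute [local instance] MvPolynomial.gradedAlgebra

/-! ## The charts are non-empty -/

section Charts

include hm in
/-- **The chart `{x_i ≠ 0}` of `M` contains the generic point** (`M` integral, `C ⊗ W` non-empty).
[folklore] -/
theorem genericPoint_mem_U_fst [IsIntegral ↑(MM)] [Nonempty (CC ⊗ W).left] (i : Fin (r + 3)) :
    genericPoint ↑(MM) ∈ (UX) i := by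
  obtain ⟨i', hi'⟩ := exists_ne i
  obtain ⟨z, hz⟩ : ∃ z : (XX).left, (ιX) z ∈ Proj.basicOpen _ (MvPolynomial.X i) := by
    obtain ⟨z, hz⟩ := exists_notMem_fermatCoordHyperplane (n := r) (m := m) hm hi'
    exact ⟨z, by simpa [fermatCoordHyperplane] using hz⟩
  haveI : Surjective (Over.hom (CC ⊗ W)) := surjective_hom_of_nonempty _
  obtain ⟨p, hp⟩ := (pX).surjective z
  refine RatFn.genericPoint_mem_of_mem (x := p) ?_
  change (pX ≫ ιX) p ∈ Proj.basicOpen _ (MvPolynomial.X i)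
  rw [Scheme.Hom.comp_apply, hp]
  exact hz

include hm in
/-- **The chart `{y_l ≠ 0}` of `M` contains the generic point** (`M` integral, `X`, `W` non-empty).
[folklore] -/
theorem genericPoint_mem_U_snd [IsIntegral ↑(MM)] [Nonempty (XX).left] [Nonempty W.left]
    (l : Fin 3) : genericPoint ↑(MM) ∈ (UC) l := by
  obtain ⟨l', hl'⟩ := exists_ne l
  obtain ⟨c, hc⟩ : ∃ c : (CC).left, (ιC) c ∈ Proj.basicOpen _ (MvPolynomial.X l) := by
    obtain ⟨c, hc⟩ := exists_notMem_fermatCoordHyperplane (n := 0) (m := m) hm hl'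
    exact ⟨c, by simpa [fermatCoordHyperplane] using hc⟩
  haveI : Surjective W.hom := surjective_hom_of_nonempty _
  haveI : Surjective (Over.hom XX) := surjective_hom_of_nonempty _
  obtain ⟨q, hq⟩ := (pullback.fst (Over.hom CC) W.hom).surjective c
  obtain ⟨p, hp⟩ := (pullback.snd (Over.hom XX) (Over.hom (CC ⊗ W))).surjective q
  refine RatFn.genericPoint_mem_of_mem (x := p) ?_
  have hpc : (pC) p = c := by
    rw [Scheme.Hom.comp_apply, hp]
    exact hq
  change (pC ≫ ιC) p ∈ Proj.basicOpen _ (MvPolynomial.X l)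
  rw [Scheme.Hom.comp_apply, hpc]
  exact hc

end Charts

/-! ## The homogeneous coordinates `ζ` of `ψ` in `K(M)` and `Σ ζ_cᵐ = 0` -/

section Zeta

/-- **`Σ_j α_jᵐ = 0`** for `α_j = [x_j/x_i]` (any base chart `i`): the Fermat equation of `X` read
in `K(M)`. [cite: ShiodaKatsura1979, §1 (1.1)] -/
theorem sum_ofSection_ratio_fst_pow [IsIntegral ↑(MM)] (hm : 1 ≤ m) {i : Fin (r + 3)}
    (hi : genericPoint ↑(MM) ∈ (UX) i) :
    ∑ j, RatFn.ofSection hi ((ρX) i j) ^ m = 0 := by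
  have hr : Set.range (pX ≫ ιX) ⊆ ProjectiveSpectrum.zeroLocus _ {fermatPolynomial ℂ (r + 1) m} := by
    rw [Scheme.Hom.comp_base, TopCat.coe_comp, ← SmoothHypersurface.range_hypersurfaceι]
    exact Set.range_comp_subset_range _ _
  have h := SmoothHypersurface.sum_homRatio_pow_eq_zero_of_range_subset (k := ℂ) hm (pX ≫ ιX) hr i
  have h2 : RatFn.ofSection hi (∑ c, (ρX) i c ^ m) = 0 := by rw [h]; exact ofSection_zero hi
  rw [← h2]
  change _ = ((MM).presheaf.germ _ _ hi).hom (∑ c, (ρX) i c ^ m)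
  rw [map_sum]
  simp only [map_pow]

/-- **`Σ_l β_lᵐ = 0`** for `β_l = [y_l/y_{l₀}]`: the Fermat equation of `C` read in `K(M)`.
[cite: ShiodaKatsura1979, §1 (1.1)] -/
theorem sum_ofSection_ratio_snd_pow [IsIntegral ↑(MM)] (hm : 1 ≤ m) {l : Fin 3}
    (hl : genericPoint ↑(MM) ∈ (UC) l) :
    ∑ l', RatFn.ofSection hl ((ρC) l l') ^ m = 0 := by
  have hr : Set.range (pC ≫ ιC) ⊆ ProjectiveSpectrum.zeroLocus _ {fermatPolynomial ℂ 1 m} := by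
    rw [Scheme.Hom.comp_base, TopCat.coe_comp, ← SmoothHypersurface.range_hypersurfaceι]
    exact Set.range_comp_subset_range _ _
  have h := SmoothHypersurface.sum_homRatio_pow_eq_zero_of_range_subset (k := ℂ) hm (pC ≫ ιC) hr l
  have h2 : RatFn.ofSection hl (∑ c, (ρC) l c ^ m) = 0 := by rw [h]; exact ofSection_zero hl
  rw [← h2]
  change _ = ((MM).presheaf.germ _ _ hl).hom (∑ c, (ρC) l c ^ m)
  rw [map_sum]
  simp only [map_pow]

/-- **`ψ` lands in the Fermat variety: `Σ_c ζ_cᵐ = 0`** for the vector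
`ζ = (β₂ α₀, …, β₂ α_{r+1}, ε α_{r+2} β₀, ε α_{r+2} β₁)` with `α_j = [x_j/x₀]`, `β_l = [y_l/y₀]`
in `K(M)` and any `ε ∈ K(M)` with `εᵐ = -1`. [cite: ShiodaKatsura1979, §1 (1.8) and Thm. 1.7 (i)] -/
theorem sum_zeta_pow_eq_zero [IsIntegral ↑(MM)] (hm : 1 ≤ m) (h0X : genericPoint ↑(MM) ∈ (UX) 0)
    (h0C : genericPoint ↑(MM) ∈ (UC) 0) (ε : (MM).functionField) (hε : ε ^ m = -1) :
    ∑ c, (Fin.addCases (motive := fun _ ↦ (MM).functionField)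
        (fun j : Fin (r + 2) ↦ RatFn.ofSection h0C ((ρC) 0 (Fin.last 2)) *
          RatFn.ofSection h0X ((ρX) 0 (Fin.castSucc j)))
        (fun l' : Fin 2 ↦ ε * RatFn.ofSection h0X ((ρX) 0 (Fin.last (r + 2))) *
          RatFn.ofSection h0C ((ρC) 0 (Fin.castSucc l'))) c) ^ m = 0 := by
  rw [Fin.sum_univ_add]
  simp only [Fin.addCases_left, Fin.addCases_right, mul_pow, ← Finset.mul_sum]
  have hX := sum_ofSection_ratio_fst_pow r W hm h0X
  rw [Fin.sum_univ_castSucc] at hX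
  have hC := sum_ofSection_ratio_snd_pow r W hm h0C
  rw [Fin.sum_univ_castSucc] at hC
  rw [eq_neg_of_add_eq_zero_left hX, eq_neg_of_add_eq_zero_left hC, hε]
  ring

end Zeta

/-! ## Local sections on the chart `{x_i ≠ 0, y_l ≠ 0}` -/

section Local

/-- **`ζ_c = (α_i β_l) · [w_c]` on the chart `{x_i ≠ 0, y_l ≠ 0}`**, where
`w = (v a_j ; ε u b_{l'})` are regular sections on that chart (`a_j = x_j/x_i`, `u = x_{r+2}/x_i`,
`b_{l'} = y_{l'}/y_l`, `v = y₂/y_l`, `ε` a global section with `[ε] = ε`), and `α_i β_l ≠ 0`.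
[cite: ShiodaKatsura1979, §1 (1.8) and Thm. 1.7 (i)] -/
theorem zeta_eq_mul_ofSection [IsIntegral ↑(MM)] (h0X : genericPoint ↑(MM) ∈ (UX) 0)
    (h0C : genericPoint ↑(MM) ∈ (UC) 0) {i : Fin (r + 3)} {l : Fin 3}
    (hi : genericPoint ↑(MM) ∈ (UX) i) (hl : genericPoint ↑(MM) ∈ (UC) l)
    (εs : Γ(MM, ⊤)) (c : Fin (r + 2 + 2)) :
    RatFn.ofSection h0X ((ρX) 0 i) * RatFn.ofSection h0C ((ρC) 0 l) ≠ 0 ∧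
    Fin.addCases (motive := fun _ ↦ (MM).functionField)
        (fun j : Fin (r + 2) ↦ RatFn.ofSection h0C ((ρC) 0 (Fin.last 2)) *
          RatFn.ofSection h0X ((ρX) 0 (Fin.castSucc j)))
        (fun l' : Fin 2 ↦ RatFn.ofSection (Opens.mem_top _) εs *
          RatFn.ofSection h0X ((ρX) 0 (Fin.last (r + 2))) *
          RatFn.ofSection h0C ((ρC) 0 (Fin.castSucc l'))) c =
      (RatFn.ofSection h0X ((ρX) 0 i) * RatFn.ofSection h0C ((ρC) 0 l)) *
        RatFn.ofSection (U := (UX) i ⊓ (UC) l) ⟨hi, hl⟩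
          (Fin.addCases (motive := fun _ ↦ Γ(MM, (UX) i ⊓ (UC) l))
            (fun j : Fin (r + 2) ↦
              (MM).presheaf.map (homOfLE inf_le_right).op ((ρC) l (Fin.last 2)) *
              (MM).presheaf.map (homOfLE inf_le_left).op ((ρX) i (Fin.castSucc j)))
            (fun l' : Fin 2 ↦ (MM).presheaf.map (homOfLE le_top).op εs *
              (MM).presheaf.map (homOfLE inf_le_left).op ((ρX) i (Fin.last (r + 2))) *
              (MM).presheaf.map (homOfLE inf_le_right).op ((ρC) l (Fin.castSucc l'))) c) := by
  have hαi : RatFn.ofSection h0X ((ρX) 0 i) ≠ 0 :=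
    GeneratingSections.ofSection_ratio_ne_zero (GeneratingSections.ofHom (pX ≫ ιX)) h0X hi
  have hβl : RatFn.ofSection h0C ((ρC) 0 l) ≠ 0 :=
    GeneratingSections.ofSection_ratio_ne_zero (GeneratingSections.ofHom (pC ≫ ιC)) h0C hl
  refine ⟨mul_ne_zero hαi hβl, ?_⟩
  have hil : genericPoint ↑(MM) ∈ (UX) i ⊓ (UC) l := ⟨hi, hl⟩
  -- the ratios over the chart `(i, l)` in terms of the base ratios
  have hX : ∀ j, RatFn.ofSection hil ((MM).presheaf.map (homOfLE inf_le_left).op ((ρX) i j)) =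
      RatFn.ofSection h0X ((ρX) 0 j) / RatFn.ofSection h0X ((ρX) 0 i) := fun j ↦ by
    rw [RatFn.ofSection_map]
    exact GeneratingSections.ofSection_ratio_eq_div (GeneratingSections.ofHom (pX ≫ ιX)) h0X hi j
  have hC : ∀ l', RatFn.ofSection hil ((MM).presheaf.map (homOfLE inf_le_right).op ((ρC) l l')) =
      RatFn.ofSection h0C ((ρC) 0 l') / RatFn.ofSection h0C ((ρC) 0 l) := fun l' ↦ by
    rw [RatFn.ofSection_map]
    exact GeneratingSections.ofSection_ratio_eq_div (GeneratingSections.ofHom (pC ≫ ιC)) h0C hl l'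
  have hE : RatFn.ofSection hil ((MM).presheaf.map (homOfLE le_top).op εs) =
      RatFn.ofSection (Opens.mem_top _) εs := RatFn.ofSection_map _ _ _
  induction c using Fin.addCases with
  | left j =>
    simp only [Fin.addCases_left]
    rw [ofSection_mul, hX, hC]
    field_simp
  | right l' =>
    simp only [Fin.addCases_right]
    rw [ofSection_mul, ofSection_mul, hX, hC, hE]
    field_simp

end Local

end Literature.AlgebraicGeometry.HodgeTheory

end
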